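import Summits.BirchSwinnertonDyer.BirchSwinnertonDyer.Theorems.EisensteinPrimesB11DescentCertificate
import Summits.BirchSwinnertonDyer.Rank1Residual.X2.RouteGSplitDisplay370758c1Local
import Summits.BirchSwinnertonDyer.Rank1Residual.Partition.EisensteinKernelCertificate
import HarnessLib

/-!
# Row B11 per pair, PREPRINT-FREE descent road — display `366f1 @ 3` (SPLIT-notGV; RULING L78 (3) desk-spot cell):
# `BSD(366f1, 3)` from Gross–Zagier–Kolyvagin alone + the two READS (cell `bsd-eis`, seat `bsd-eis-k5-p4` g0; door
# `Theorems/EisensteinPrimesB11DescentCertificate.lean` p536512; THEOREMS ONLY — nothing booked)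

HONEST FRAMING (cell `bsd-eis`, run/shared/lean/pub/bsd-eis/; row B11 = X2c = `CellC`; crux 4 `BSDpOnCellC` stmt-BirchSwinnertonDyer-19034
OPEN; no label or count moves; BSD proved for no curve unconditionally; `BSDp` only — no main-conjecture conjunct on this road). Table row
`366f @3` of `pub/bsd-eis/k5-p4-g0/B11-DESC3R1-TABLE-v1.tsv` (3ba341440843231c): VERDICT `CERT`; record `366f1 = [1, 0, 1, -5, 20]` (`N = 366 = 2·3·61`,
SPLIT multiplicative at `3`, ψ-even), kernel `x` (`x₀ = 0`), `(s_φ̂, s_φ, m, EXCESS) = (1, 1, 2, 0)` on `isogchi` ‖ `isogcft` FIELD-IDENTICAL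
(`m = 2`: rank `1` + the rational kernel point of order `3`); member `366f2`: `(1, 1, 2, 0)`; `#Ш_an = 1` on both (Cremona = PARI leg).
**IN THE KERNEL:** `isElliptic_366f1`, `isGloballyMinimal_366f1`, `split_366f1` IMPORTED BY NAME from `X2/RouteGSplitDisplay370758c1Local.lean`
(k5 route-G display; not restated); NEW here: `E[3]` reducible by the rational `Ψ₃`-root `x₀ = 0` (`Ψ₂Sq(0) = b₆ = 81 ≠ 0`), hence
`ClassX2 366f1 3`. **READ (hypotheses):** `hr : r_an = 1`, `hq`/`hv` : `#Ш_an = q`, `ord₃ q = 0`, `h : Ш[3] = 0` (EXCESS `= 0`, two engines,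
kit j280759). **PUBLISHED fact BY NAME:** `hGZK` only.
Refs: [Miller2011LMS] Def. 1.1; [SilvermanAEC2009] Ex. 3.7, X.4.2; Cremona `ecdata` class 366f.
-/

set_option autoImplicit false
set_option linter.dupNamespace false

noncomputable section

open scoped Classical

open WeierstrassCurve Literature.NumberTheory.EllipticCurves
  Literature.NumberTheory.EllipticCurves.Rank1Residual
  Literature.NumberTheory.EllipticCurves.Rank1Residual.Typed
  Summit.BirchSwinnertonDyer.Rank1Residual
  Summit.BirchSwinnertonDyer.Rank1Residual.X2
  Summit.BirchSwinnertonDyer.Rank1Residual.X2.RouteGSplitDisplay370758c1Local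
  Summit.BirchSwinnertonDyer.BirchSwinnertonDyer.Theorems.B11DescentCertificate

namespace Summit.BirchSwinnertonDyer.BirchSwinnertonDyer.Theorems.B11Descent366f1

/-- **`366f1[3]` is reducible — IN THE KERNEL**: `x₀ = 0` is a rational root of `Ψ₃` with `Ψ₂Sq(0) = b₆ = 81 ≠ 0` (the `x`-coordinate of
the rational `3`-torsion point generating the kernel of `366f1 → 366f2`). [cite: SilvermanAEC2009, Ex. 3.7 and III.2.3] -/
theorem not_irreducible_366f1 : ¬ (⟨1, 0, 1, -5, 20⟩ : WeierstrassCurve ℚ).HasIrreducibleModPGaloisRep 3 := by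
  haveI := isElliptic_366f1
  obtain ⟨Φ, P, y, h, hΦ, -⟩ :=
    KernelDisc.exists_isRationalLine_of_eval_Ψ₃_eq_zero (W := ⟨1, 0, 1, -5, 20⟩) 0
      (by norm_num [WeierstrassCurve.Ψ₃, WeierstrassCurve.b₂, WeierstrassCurve.b₄, WeierstrassCurve.b₆,
            WeierstrassCurve.b₈])
      (by rw [KernelDisc.eval_Ψ₂Sq]; norm_num [WeierstrassCurve.b₂, WeierstrassCurve.b₄, WeierstrassCurve.b₆])
  exact not_hasIrreducibleModPGaloisRep_of_isRationalLine hΦ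

/-- **`(366f1, 3)` lies in class X2** (`3` odd, `E[3]` reducible, `3 ‖ N` split multiplicative — `split_366f1` of the route-G display) — in the
kernel. [folklore] -/
theorem classX2_366f1 : ClassX2 (⟨1, 0, 1, -5, 20⟩ : WeierstrassCurve ℚ) 3 :=
  ⟨by decide, not_irreducible_366f1, split_366f1.hasMultiplicativeReductionAtPrime⟩

/-- **X2c INSTANCE, DESCENT ROAD — `BSD(366f1, 3)` at a SPLIT Eisenstein prime** from Gross–Zagier–Kolyvagin (`hGZK`) and the two READS on
`366f1`, through `X2.cellC_bsdp_of_shaAn_unit_of_noPTorsion`. No `𝓛`-invariant, no Iwasawa input. Nothing booked; `BSDp` only.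
[cite: Miller2011LMS, §1 and Def. 1.1] -/
theorem bsdp_366f1_at_three_of_descent (hGZK : rank_eq_analyticRank_of_analyticRank_le_one)
    (W : WeierstrassCurve ℚ) [W.IsElliptic] [W.IsGloballyMinimal] (hW : W = ⟨1, 0, 1, -5, 20⟩)
    (hr : W.analyticRank = 1) {q : ℚ} (hq : shaAn W = (q : ℂ)) (hv : padicValRat 3 q = 0)
    (h : ∀ x : W.sha, (3 : ℤ) • x = 0 → x = 0) : BSDp W 3 := by
  subst hW
  exact X2.cellC_bsdp_of_shaAn_unit_of_noPTorsion _ 3 hGZK ⟨hr, classX2_366f1⟩ hq hv h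

/-- **The same on the route's cell predicate**: `CellC 366f1 3 → BSD(366f1, 3)` modulo GZK and the two reads.
[cite: Miller2011LMS, §1 and Def. 1.1] -/
theorem targetC_366f1_at_three_of_descent (hGZK : rank_eq_analyticRank_of_analyticRank_le_one)
    (W : WeierstrassCurve ℚ) [W.IsElliptic] [W.IsGloballyMinimal] (hW : W = ⟨1, 0, 1, -5, 20⟩)
    {q : ℚ} (hq : shaAn W = (q : ℂ)) (hv : padicValRat 3 q = 0) (h : ∀ x : W.sha, (3 : ℤ) • x = 0 → x = 0) :
    CellC W 3 → BSDp W 3 :=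
  fun hc ↦ bsdp_366f1_at_three_of_descent hGZK W hW hc.1 hq hv h

/-- **DECISION at the pair**: under the descent read `Ш(366f1)[3] = 0`, `BSD(366f1, 3) ↔ ord₃ #Ш_an = 0`. [cite: Miller2011LMS, §1 and Def. 1.1] -/
theorem bsdp_366f1_at_three_iff_of_descent (hGZK : rank_eq_analyticRank_of_analyticRank_le_one)
    (W : WeierstrassCurve ℚ) [W.IsElliptic] [W.IsGloballyMinimal] (hW : W = ⟨1, 0, 1, -5, 20⟩)
    (hr : W.analyticRank = 1) (h : ∀ x : W.sha, (3 : ℤ) • x = 0 → x = 0) {q : ℚ} (hq : shaAn W = (q : ℂ)) :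
    BSDp W 3 ↔ padicValRat 3 q = 0 := by
  subst hW
  exact X2.cellC_bsdp_iff_padicValRat_shaAn_eq_zero_of_noPTorsion _ 3 hGZK ⟨hr, classX2_366f1⟩ h hq

end Summit.BirchSwinnertonDyer.BirchSwinnertonDyer.Theorems.B11Descent366f1

end
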